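import Literature.NumberTheory.EllipticCurves.Kato2004.LocPKernelRankOnePlumbing
import Literature.NumberTheory.EllipticCurves.Kato2004.IwasawaH1ReductionKernel
import Literature.NumberTheory.EllipticCurves.Kato2004.IwasawaH1ReductionSeparated
import Literature.NumberTheory.EllipticCurves.H1UnramifiedFiniteProofs
import Literature.NumberTheory.EllipticCurves.GoodReductionUnramifiedProofs
import Literature.NumberTheory.EllipticCurves.IsogenyFrobeniusTraceProofs
import Literature.NumberTheory.EllipticCurves.HasseWeilGoodReduction
import Literature.NumberTheory.EllipticCurves.TateModuleFree
import Mathlib.RingTheory.AdicCompletion.Functoriality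
import HarnessLib

/-!
# Kato 2004 (Astérisque 295) §8.2 / (12.2.1) at the bottom layer: the integral classes
# `H¹(ℤ[1/p], T_pW) ⊆ H¹(ℚ, T_pW)` form a FINITELY GENERATED `ℤ_p`-module — for every elliptic
# `W/ℚ` and every prime `p`

Topic `NumberTheory/EllipticCurves`, sub-directory `Kato2004` (namespace = path).  Cell `bsd-cn100`,
prover seat `bsd-cn100-s2-c3` (g10).  `Proofs`-style file: theorems only (no definition, no named
fact, no `sorry`, no instance, no notation).

## What

* `module_finite_integralH1_top` — `Kato2004.integralH1 (tateRep W p) p ⊤`, the `ℤ_p`-submodule of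
  `H¹(⊤, T_pW) = H¹(ℚ, T_pW)` of classes unramified at every prime `𝔓 ∤ p` of `ℤ̄` (Kato's
  `H¹(ℤ[1/p], T_pW)`, §8.2 / Lemma 8.5), is a finitely generated `ℤ_p`-module;
* `module_finite_integralH1_layerZero` — the same at the bottom layer `κ.layerSubgroup 0` of any
  `ℤ_p`-extension datum `κ` (the object `A = H¹(ℤ[1/p], T_pW)` pinned by the descent packages
  `Kato2004.IwasawaH2Data` / `Kato2004.MemberHullInputs`, and the numerator of the pinned descent
  cokernel of `Kato2004.finite_descentCokernel_of_rankOne`).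

This is the `ℤ_p`-finiteness input of Kato's (12.2.1) ("`𝐇¹(T)` and `𝐇²(T)` are finitely generated")
read at the bottom layer, and one of the two contents of the construction fact
`Kato2004.nonempty_iwasawaH2Data` (the other being the injectivity half of (14.14.1)).  Weak
Mordell–Weil-type finiteness for the `p`-adic Tate module: Silverman, *AEC*, Lemma X.4.3 for the
finite module `W[p]` (tree theorem `finite_h1Unramified_holds`) plus Nakayama's lemma for the
`p`-adically complete ring `ℤ_p`.  HONEST FRAMING: Galois-cohomology bookkeeping valid for every
`W/ℚ` and every `p`; it discharges no named fact by itself; nothing about BSD is claimed.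

## Proof

Let `S` be the finite set of bad places of `W` and let `J ⊇ integralH1` be the submodule of
`H¹(⊤, T_pW)` of classes whose restriction to `⊤ ⊓ I_𝔓` vanishes for every `𝔓` over every GOOD
`v ≠ p`.
1. Reduction modulo `p` followed by `ofTopSubgroup` maps `J` into
   `H¹(Γ_ℚ, W[p]; S ∪ {p})` (`h1Unramified`), a FINITE group (AEC X.4.3,
   `finite_h1Unramified_holds`); the dialect bridge is the per-prime form of
   `ofTopSubgroup_mem_unramifiedKer_of_mem_integralH1`.
2. Its kernel on `J` is `p • J`: `ker (red) = p · H¹(⊤, T_pW)` (Kato §13.8 levelwise,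
   `reduceH1_eq_zero_iff`), and `p • z ∈ J ⇒ z ∈ J` because `H¹(⊤ ⊓ I_𝔓, T_pW)` has no `p`-torsion
   when `I_𝔓` acts trivially on `T_pW` (AEC VII.4.1(b), `smul_tateModule_eq_of_mem_inertia`; a
   cocycle of a trivially acting group killed by `p` up to a coboundary is killed by `p`, and `T_pW`
   has no `p`-torsion).
3. `J` is `p`-adically separated (`⋂ p^k H¹(⊤, T_pW) = 0`, `eq_zero_of_forall_mem_pow_smul`).
4. Nakayama for the complete ring `ℤ_p` (Mathlib `surjective_of_mkQ_comp_surjective`, as in the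
   tree's `TateModule.finite_of_finite_torsionBy`): lifts of the finitely many values generate `J`.
5. `integralH1 ⊤ ≤ J`, and the bottom layer embeds by `layerZeroToTop` (injective, `ℤ_p`-linear,
   integral ↦ integral).

References: K. Kato, Astérisque 295 (2004) §8.2 / Lemma 8.5, §12.2 (12.2.1), §13.8;
J. H. Silverman, *AEC* (2009) VII.4.1, X.4.3; J.-P. Serre, *Galois Cohomology* I §2;
Stacks Project Tag 031D (Nakayama for complete rings).
-/

noncomputable section

open scoped Classical NumberField

open CategoryTheory Field IsDedekindDomain NumberField
open Literature.NumberTheory.GaloisRepresentations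
open Literature.NumberTheory.EllipticCurves Literature.NumberTheory.EllipticCurves.Kato2004
open Literature.NumberTheory.EllipticCurves.Kato2004.EulerSystemValues
open WeierstrassCurve (geomPoints geomTorsion galH1Torsion torsionPoints torsionGaloisModule)

namespace Literature.NumberTheory.EllipticCurves.Kato2004

namespace IntegralH1Finite

/-! ## §1 Nakayama for `ℤ_p`: a separated module with finitely many residues of a map whose
kernel is `p`-divisible is finitely generated -/

/-- **Nakayama over the complete ring `ℤ_p`.**  Let `M` be a `ℤ_p`-module which is `p`-adically
separated (`⋂_k p^k M = 0`), and `r : M →+ G` an additive map with finitely many values whose kernel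
consists of `p`-multiples.  Then `M` is finitely generated over `ℤ_p` (lifts of the values generate:
Mathlib's `surjective_of_mkQ_comp_surjective` for the `p`-adically complete free module
`ι → ℤ_p`, tree `isAdicComplete_pi`). [cite: SilvermanAEC2009, Prop. III.7.1 (proof)] -/
theorem module_finite_of_addMonoidHom {p : ℕ} [Fact p.Prime] {M : Type*} [AddCommGroup M]
    [Module ℤ_[p] M] {G : Type*} [AddCommGroup G] (r : M →+ G) (F : AddSubgroup G) [Finite F]
    (hr : ∀ x, r x ∈ F) (hker : ∀ x, r x = 0 → ∃ y : M, (p : ℤ_[p]) • y = x)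
    (hsep : ∀ x : M, (∀ k : ℕ, ∃ y : M, ((p : ℤ_[p]) ^ k) • y = x) → x = 0) :
    Module.Finite ℤ_[p] M := by
  classical
  haveI : Fintype F := Fintype.ofFinite _
  -- a lift `s g ∈ M` of each value `g` of `r` (else `0`)
  let s : F → M := fun g ↦ if hg : ∃ m : M, r m = g then hg.choose else 0
  have hs : ∀ x : M, r (s ⟨r x, hr x⟩) = r x := fun x ↦ by
    have hx : ∃ m : M, r m = ((⟨r x, hr x⟩ : F) : G) := ⟨x, rfl⟩
    simp only [s, dif_pos hx]
    exact hx.choose_spec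
  let f : (F → ℤ_[p]) →ₗ[ℤ_[p]] M := Fintype.linearCombination ℤ_[p] s
  haveI : IsAdicComplete (IsLocalRing.maximalIdeal ℤ_[p]) (F → ℤ_[p]) := isAdicComplete_pi _ _
  -- `M` is `𝔪`-adically separated
  haveI : IsHausdorff (IsLocalRing.maximalIdeal ℤ_[p]) M := by
    refine ⟨fun x hx ↦ hsep x fun k ↦ ?_⟩
    have hk : x ∈ (IsLocalRing.maximalIdeal ℤ_[p] ^ k • ⊤ : Submodule ℤ_[p] M) := SModEq.zero.mp (hx k)
    rw [PadicInt.maximalIdeal_eq_span_p, Ideal.span_singleton_pow] at hk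
    refine Submodule.smul_induction_on (p := fun b ↦ ∃ y : M, ((p : ℤ_[p]) ^ k) • y = b) hk
      (fun a ha b _ ↦ ?_) (fun x y hx hy ↦ ?_)
    · obtain ⟨c, rfl⟩ := Ideal.mem_span_singleton'.mp ha
      exact ⟨c • b, by rw [smul_smul, mul_comm]⟩
    · obtain ⟨x', hx'⟩ := hx
      obtain ⟨y', hy'⟩ := hy
      exact ⟨x' + y', by rw [smul_add, hx', hy']⟩
  -- `f` is surjective modulo `𝔪 M`, hence surjective
  have hf : Function.Surjective
      ((IsLocalRing.maximalIdeal ℤ_[p] • ⊤ : Submodule ℤ_[p] M).mkQ ∘ₗ f) := by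
    intro q
    obtain ⟨x, rfl⟩ := Submodule.mkQ_surjective _ q
    refine ⟨Pi.single ⟨r x, hr x⟩ 1, ?_⟩
    simp only [LinearMap.coe_comp, Function.comp_apply, f, Fintype.linearCombination_apply_single,
      one_smul, Submodule.mkQ_apply]
    rw [Submodule.Quotient.eq]
    obtain ⟨y, hy⟩ := hker (s ⟨r x, hr x⟩ - x) (by rw [map_sub, hs x, sub_self])
    rw [← hy]
    refine Submodule.smul_mem_smul ?_ Submodule.mem_top
    rw [PadicInt.maximalIdeal_eq_span_p]
    exact Ideal.mem_span_singleton_self _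
  exact Module.Finite.of_surjective f (surjective_of_mkQ_comp_surjective hf)

/-! ## §2 Cohomological inputs: no `p`-torsion in `H¹` of a trivially acting subgroup, and the
per-prime dialect bridge -/

variable (W : WeierstrassCurve ℚ) [W.IsElliptic] (p : ℕ) [Fact p.Prime]
  [ContinuousSMul ℤ_[p] (W.tateModule p)]

/-- **`H¹(V, T_pW)` has no `p`-torsion when `V ≤ Γ_ℚ` acts trivially on `T_pW`**: a continuous
cocycle of `V` is then a continuous homomorphism, coboundaries vanish, and `p • φ = 0` forces `φ = 0`
because `T_pW` has no `p`-torsion. [cite: SerreGaloisCohomology1997, I §2.2]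
[cite: SilvermanAEC2009, Prop. III.7.1] -/
theorem eq_zero_of_prime_smul_eq_zero_of_forall_smul_eq (V : Subgroup (absoluteGaloisGroup ℚ))
    (hV : ∀ g ∈ V, ∀ a : W.tateModule p, g • a = a) (c : H1 (tateRep W p) V)
    (hc : (p : ℤ_[p]) • c = 0) : c = 0 := by
  obtain ⟨φ, rfl⟩ := oneCocycleClass_surjective _ c
  rw [← oneCocycleClass_smul, oneCocycleClass_eq_zero_iff] at hc
  obtain ⟨v, hv⟩ := hc
  have hρ : ∀ (g : V) (a : W.tateModule p),
      (subgroupRep (tateRep W p).toTopRep V).ρ g a = (g : absoluteGaloisGroup ℚ) • a :=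
    fun g a ↦ rfl
  refine (oneCocycleClass_eq_zero_iff _ _).mpr ⟨0, fun g ↦ ?_⟩
  rw [map_zero, sub_zero]
  have h1 : (p : ℤ_[p]) • φ.1 g = 0 := by
    have h := hv g
    rw [hρ, hV g g.2, sub_self] at h
    simpa using h
  rw [Nat.cast_smul_eq_nsmul] at h1
  exact TateModule.eq_zero_of_prime_nsmul_eq_zero h1

omit [W.IsElliptic] [Fact p.Prime] [ContinuousSMul ℤ_[p] (W.tateModule p)] in
/-- **The per-prime dialect bridge** (the proof of
`ofTopSubgroup_mem_unramifiedKer_of_mem_integralH1` read at ONE prime): a class of `H¹(⊤, W[n])`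
whose restriction to `⊤ ⊓ I_𝔓` vanishes, moved to `H¹(Γ_ℚ, W[n])` by `ofTopSubgroup`, lies in
`unramifiedKer (W[n]) 𝔓`. [cite: Kato2004Asterisque, §8.2 and Lemma 8.5 (pp. 180–184)]
[cite: SilvermanAEC2009, VIII.§2 Definition p. 191] -/
theorem ofTopSubgroup_mem_unramifiedKer_of_resLe_eq_zero (n : ℤ)
    (r : H1 (W.torsionGaloisModule n) ⊤) (𝔓 : Ideal (absIntegers (𝓞 ℚ) ℚ))
    (h0 : resLe (W.torsionGaloisModule n).toTopRep
      (inf_le_left : (⊤ : Subgroup (absoluteGaloisGroup ℚ)) ⊓ 𝔓.inertia (absoluteGaloisGroup ℚ) ≤ ⊤)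
      1 r = 0) :
    (ofTopSubgroup (W.torsionGaloisModule n).toTopRep 1).hom r ∈ unramifiedKer (geomTorsion W n) 𝔓 := by
  obtain ⟨ψ, rfl⟩ := oneCocycleClass_surjective _ r
  rw [resLe_oneCocycleClass] at h0
  obtain ⟨m, hm⟩ := (oneCocycleClass_eq_zero_iff _ _).mp h0
  have hc : (ofTopSubgroup (W.torsionGaloisModule n).toTopRep 1).hom (oneCocycleClass _ ψ) =
      ContinuousCohomology.map toTopSubgroupHom (X := subgroupRep (W.torsionGaloisModule n).toTopRep ⊤)
        (Y := (W.torsionGaloisModule n).toTopRep)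
        (TopRep.ofHom ⟨ContinuousLinearMap.id ℤ (geomTorsion W n), fun _ => rfl⟩) 1
        (oneCocycleClass _ ψ) := rfl
  rw [hc, map_oneCocycleClass]
  change oneCocycleClass (discreteTopRep (absoluteGaloisGroup ℚ) (geomTorsion W n)) _ ∈ _
  rw [unramifiedKer, oneCocycleClass_mem_subgroupResKer_iff]
  refine ⟨m, fun σ => ?_⟩
  exact hm ⟨σ.1, ⟨trivial, σ.2⟩⟩

omit [ContinuousSMul ℤ_[p] (W.tateModule p)] in
/-- At a prime `𝔓` of `ℤ̄` above a GOOD place `v ∤ p`, the subgroup `⊤ ⊓ I_𝔓` acts trivially on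
`T_pW` (AEC VII.4.1(b), `smul_tateModule_eq_of_mem_inertia`). [cite: SilvermanAEC2009, Prop. VII.4.1(b)] -/
theorem forall_smul_eq_of_hasGoodReductionAt {v : HeightOneSpectrum (𝓞 ℚ)}
    (hv : W.HasGoodReductionAt v)
    (hvp : ((Rat.HeightOneSpectrum.primesEquiv v : Nat.Primes) : ℕ) ≠ p)
    {𝔓 : Ideal (absIntegers (𝓞 ℚ) ℚ)} (h𝔓 : 𝔓 ∈ v.primesAbove) :
    ∀ g ∈ (⊤ : Subgroup (absoluteGaloisGroup ℚ)) ⊓ 𝔓.inertia (absoluteGaloisGroup ℚ),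
      ∀ a : W.tateModule p, g • a = a := fun _ hg a ↦
  W.smul_tateModule_eq_of_mem_inertia p hv
    (WeierstrassCurve.natCast_not_mem_asIdeal_of_primesEquiv_ne (Fact.out : p.Prime) hvp) h𝔓 hg.2 a

end IntegralH1Finite

open IntegralH1Finite

variable (W : WeierstrassCurve ℚ) [W.IsElliptic] (p : ℕ) [Fact p.Prime]
  [ContinuousSMul ℤ_[p] (W.tateModule p)]

/-- **`H¹(ℤ[1/p], T_pW)` is a finitely generated `ℤ_p`-module** (Kato (12.2.1) at the bottom
layer; weak Mordell–Weil finiteness for the `p`-adic Tate module): the `ℤ_p`-submodule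
`Kato2004.integralH1 (tateRep W p) p ⊤` of `H¹(⊤, T_pW)` — classes unramified at every `𝔓 ∤ p` — is
finitely generated, for EVERY elliptic `W/ℚ` and EVERY prime `p`.  Proof: module docstring, steps 1–5
(reduction mod `p` into the finite `H¹(Γ_ℚ, W[p]; S ∪ {p})`, kernel `= p·`, `p`-adic separatedness,
Nakayama over `ℤ_p`). [cite: Kato2004Asterisque, §8.2 Lemma 8.5 (pp. 180–184) and §12.2 (12.2.1) (p. 220)]
[cite: SilvermanAEC2009, Lemma X.4.3 and Prop. VII.4.1(b)] -/
theorem module_finite_integralH1_top : Module.Finite ℤ_[p] (integralH1 (tateRep W p) p ⊤) := by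
  classical
  have hp : p.Prime := Fact.out
  -- the finitely many bad places
  obtain ⟨S, hS⟩ : ∃ S : Finset (HeightOneSpectrum (𝓞 ℚ)), ∀ v, v ∉ S → W.HasGoodReductionAt v := by
    have h := WeierstrassCurve.eventually_hasGoodReductionAt W
    rw [Filter.eventually_cofinite] at h
    exact ⟨h.toFinset, fun v hv => by_contra fun hbad => hv (h.mem_toFinset.mpr hbad)⟩
  -- places `v ≠ primePlace p` have residue characteristic `≠ p`
  have hne : ∀ v : HeightOneSpectrum (𝓞 ℚ), v ≠ primePlace p →
      ((Rat.HeightOneSpectrum.primesEquiv v : Nat.Primes) : ℕ) ≠ p := by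
    intro v hv h
    apply hv
    apply (Rat.HeightOneSpectrum.primesEquiv (R := 𝓞 ℚ)).injective
    rw [primesEquiv_primePlace]
    exact Subtype.ext h
  -- the auxiliary submodule `J ⊇ integralH1`: vanishing on the inertia above the GOOD `v ∤ p`
  let J : Submodule ℤ_[p] (H1 (tateRep W p) ⊤) :=
    { carrier := {x | ∀ v : HeightOneSpectrum (𝓞 ℚ),
        ((Rat.HeightOneSpectrum.primesEquiv v : Nat.Primes) : ℕ) ≠ p → W.HasGoodReductionAt v →
        ∀ 𝔓 ∈ v.primesAbove,
          resLe (tateRep W p).toTopRep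
            (inf_le_left : (⊤ : Subgroup (absoluteGaloisGroup ℚ)) ⊓
              𝔓.inertia (absoluteGaloisGroup ℚ) ≤ ⊤) 1 x = 0}
      zero_mem' := fun _ _ _ _ _ ↦ map_zero _
      add_mem' := by
        intro x y hx hy v hv hgood 𝔓 h𝔓
        rw [map_add, hx v hv hgood 𝔓 h𝔓, hy v hv hgood 𝔓 h𝔓, add_zero]
      smul_mem' := by
        intro a x hx v hv hgood 𝔓 h𝔓
        rw [map_smul, hx v hv hgood 𝔓 h𝔓, smul_zero] }
  have hJ : ∀ x : H1 (tateRep W p) ⊤, x ∈ J ↔ ∀ v : HeightOneSpectrum (𝓞 ℚ),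
      ((Rat.HeightOneSpectrum.primesEquiv v : Nat.Primes) : ℕ) ≠ p → W.HasGoodReductionAt v →
        ∀ 𝔓 ∈ v.primesAbove,
          resLe (tateRep W p).toTopRep
            (inf_le_left : (⊤ : Subgroup (absoluteGaloisGroup ℚ)) ⊓
              𝔓.inertia (absoluteGaloisGroup ℚ) ≤ ⊤) 1 x = 0 := fun x ↦ Iff.rfl
  have hle : integralH1 (tateRep W p) p ⊤ ≤ J := fun x hx ↦
    (hJ x).mpr fun v hv _ 𝔓 h𝔓 ↦ (mem_integralH1_iff _ p ⊤ x).mp hx v hv 𝔓 h𝔓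
  -- `J` is closed under division by `p`
  have hdiv : ∀ z : H1 (tateRep W p) ⊤, (p : ℤ_[p]) • z ∈ J → z ∈ J := by
    intro z hz
    refine (hJ z).mpr fun v hv hgood 𝔓 h𝔓 ↦ ?_
    refine eq_zero_of_prime_smul_eq_zero_of_forall_smul_eq W p _
      (forall_smul_eq_of_hasGoodReductionAt W p hgood hv h𝔓) _ ?_
    rw [← map_smul]
    exact (hJ _).mp hz v hv hgood 𝔓 h𝔓
  -- the finite target `H¹(Γ_ℚ, W[p]; S ∪ {p})`
  set S' : Set (HeightOneSpectrum (𝓞 ℚ)) := (↑S : Set (HeightOneSpectrum (𝓞 ℚ))) ∪ {primePlace p}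
    with hS'
  have hS'fin : S'.Finite := (S.finite_toSet).union (Set.finite_singleton _)
  haveI : ContinuousSMul (absoluteGaloisGroup ℚ) (geomTorsion W (p : ℤ)) :=
    W.continuousSMul_geomTorsion (WeierstrassCurve.isOpen_stabilizer_point_holds W) (p : ℤ)
  haveI : Finite (geomTorsion W (p : ℤ)) :=
    W.finite_torsionPoints_holds (AlgebraicClosure ℚ) (by exact_mod_cast hp.ne_zero)
  haveI hfinF : Finite (h1Unramified (geomTorsion W (p : ℤ)) S') :=
    finite_h1Unramified_holds ℚ (geomTorsion W (p : ℤ)) hS'fin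
  -- the reduction map on `J`
  let r : J →+ discreteH1 (absoluteGaloisGroup ℚ) (geomTorsion W (p : ℤ)) :=
    { toFun := fun x ↦ (ofTopSubgroup (W.torsionGaloisModule (p : ℤ)).toTopRep 1).hom
        (reduceH1 W p ⊤ (x : H1 (tateRep W p) ⊤))
      map_zero' := by simp only [ZeroMemClass.coe_zero, map_zero]; rfl
      map_add' := fun x y ↦ by simp only [Submodule.coe_add, map_add]; rfl }
  have hr_apply : ∀ x : J, r x = (ofTopSubgroup (W.torsionGaloisModule (p : ℤ)).toTopRep 1).hom
      (reduceH1 W p ⊤ (x : H1 (tateRep W p) ⊤)) := fun x ↦ rfl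
  -- (1) `r` lands in the finite group
  have hr : ∀ x : J, r x ∈ h1Unramified (geomTorsion W (p : ℤ)) S' := by
    intro x
    rw [mem_h1Unramified_iff]
    intro v hvS 𝔓 h𝔓
    have hvS1 : v ∉ S := fun h ↦ hvS (Set.mem_union_left _ h)
    have hvp : v ≠ primePlace p := fun h ↦ hvS (Set.mem_union_right _ (by simp [h]))
    rw [hr_apply]
    refine ofTopSubgroup_mem_unramifiedKer_of_resLe_eq_zero W (p : ℤ) _ 𝔓 ?_
    rw [← reduceH1_resLe, (hJ _).mp x.2 v (hne v hvp) (hS v hvS1) 𝔓 h𝔓, map_zero]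
  -- (2) the kernel of `r` consists of `p`-multiples (in `J`)
  have hker : ∀ x : J, r x = 0 → ∃ y : J, (p : ℤ_[p]) • y = x := by
    intro x hx
    rw [hr_apply] at hx
    have h0 : reduceH1 W p ⊤ (x : H1 (tateRep W p) ⊤) = 0 :=
      eq_zero_of_ofTopSubgroup_eq_zero _ _ hx
    obtain ⟨z, hz⟩ := exists_smul_eq_of_reduceH1_eq_zero W p ⊤ _ h0
    have hzJ : z ∈ J := hdiv z (by rw [hz]; exact x.2)
    exact ⟨⟨z, hzJ⟩, Subtype.ext hz⟩
  -- (3) `J` is `p`-adically separated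
  have hsep : ∀ x : J, (∀ k : ℕ, ∃ y : J, ((p : ℤ_[p]) ^ k) • y = x) → x = 0 := by
    intro x hx
    refine Subtype.ext (eq_zero_of_forall_mem_pow_smul W p ⊤ (x : H1 (tateRep W p) ⊤) fun k ↦ ?_)
    obtain ⟨y, hy⟩ := hx k
    exact ⟨(y : H1 (tateRep W p) ⊤), by rw [← Submodule.coe_smul, hy]⟩
  -- (4) Nakayama
  haveI : Module.Finite ℤ_[p] J :=
    module_finite_of_addMonoidHom r (h1Unramified (geomTorsion W (p : ℤ)) S') hr hker hsep
  -- (5) `integralH1 ≤ J`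
  exact Module.Finite.of_injective (Submodule.inclusion hle) (Submodule.inclusion_injective hle)

/-- **`H¹(ℤ[1/p], T_pW)` at the bottom layer of a `ℤ_p`-extension is finitely generated over `ℤ_p`**:
for every `ℤ_p`-extension datum `κ : ZpExtension ℚ p`, the `ℤ_p`-module
`Kato2004.integralH1 (tateRep W p) p (κ.layerSubgroup 0)` — the object `A` pinned by the descent
packages `Kato2004.IwasawaH2Data` (14.14.1) and `Kato2004.MemberHullInputs`, and the numerator of
`Kato2004.IwasawaH1Data.descentCokernel` — is finitely generated (transport of
`module_finite_integralH1_top` along the injective `ℤ_p`-linear restriction `layerZeroToTop`, which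
preserves integrality). [cite: Kato2004Asterisque, §12.2 (12.2.1) (p. 220) and §14.14 (14.14.1) (p. 243)]
[cite: SilvermanAEC2009, Lemma X.4.3] -/
theorem module_finite_integralH1_layerZero (κ : ZpExtension ℚ p) :
    Module.Finite ℤ_[p] (integralH1 (tateRep W p) p (κ.layerSubgroup 0)) := by
  haveI := module_finite_integralH1_top W p
  let f : integralH1 (tateRep W p) p (κ.layerSubgroup 0) →ₗ[ℤ_[p]] integralH1 (tateRep W p) p ⊤ :=
    { toFun := fun x ↦ ⟨layerZeroToTop W p κ (x : H1 (tateRep W p) (κ.layerSubgroup 0)),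
        layerZeroToTop_mem_integralH1 W p κ x.2⟩
      map_add' := fun x y ↦ Subtype.ext (by simp only [Submodule.coe_add, map_add])
      map_smul' := fun a x ↦ Subtype.ext (by
        simp only [Submodule.coe_smul, RingHom.id_apply]
        exact layerZeroToTop_smul W p κ a x) }
  refine Module.Finite.of_injective f fun x y hxy ↦ ?_
  have h : layerZeroToTop W p κ (x : H1 (tateRep W p) (κ.layerSubgroup 0)) =
      layerZeroToTop W p κ (y : H1 (tateRep W p) (κ.layerSubgroup 0)) := congrArg Subtype.val hxy
  refine Subtype.ext ?_
  rw [← sub_eq_zero] at h ⊢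
  rw [← map_sub] at h
  exact eq_zero_of_layerZeroToTop_eq_zero W p κ _ h

end Literature.NumberTheory.EllipticCurves.Kato2004

end
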